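import Literature.RepresentationTheory.CompactGroups.MaximalTorusCentralizer
import Literature.RepresentationTheory.CompactGroups.UnitaryTrick
import Literature.NumberTheory.Automorphic.CentralizerTorusConnected
import Literature.NumberTheory.Automorphic.SubQuotRep
import Literature.NumberTheory.Automorphic.BurnsideKolchin
import HarnessLib

/-!
# A generator of a maximal torus has abelian centraliser — discharge of
`ExistsAbelianCentralizer`

Sibling proof file of `MaximalTorusCentralizer.lean`: we prove
`Literature.RepresentationTheory.CompactGroups.ExistsAbelianCentralizer_holds`, i.e. that a compact
connected topological group `G` with a faithful continuous unitary matrix representation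
`ρ : G →* M_N(ℂ)` has an element `t` whose centraliser `Z_G(t)` is abelian
(Bröcker–tom Dieck, *Representations of Compact Lie Groups* (1985), IV (2.3)(i) with I (4.13): a
topological generator `t` of a maximal torus `T` has `Z(t) = Z(T) = T`).

## The proof

The printed proof rests on the maximal torus theorem for compact connected Lie groups
(IV (1.6): every element is conjugate into `T`, by a mapping-degree argument) and on Cartan's
closed-subgroup theorem, neither of which is available over Mathlib. We follow instead the
**algebraic-group road**, every step of which is a theorem of the tree's `k`-points theory of
linear algebraic groups (`Literature.NumberTheory.Automorphic`, after Springer, *Linear Algebraic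
Groups*, 2nd ed.): let `K = ρ(G) ≤ GL_N(ℂ)` and let `𝒢 = K̄` be its Zariski closure
(`zariskiClosure`, Springer 2.2.4 (i)).

* `isZConnected_zariskiClosure_range_of_connectedSpace` — **`𝒢` is Zariski-connected**: an
  algebraic subgroup `H ≤ 𝒢` of finite index pulls back to a closed (polynomials are continuous)
  finite-index, hence open, subgroup of the connected group `G`, so `K ≤ H` and `𝒢 ≤ H`.
* `isReductiveSubgroup_zariskiClosure_of_mem_unitaryGroup` — **the Zariski closure of a group of
  unitary matrices is reductive**: if `U ◁ 𝒢` consists of unipotent matrices, its space `W` of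
  common fixed vectors is `𝒢`-stable, the Hermitian orthogonal complement `W⊥` is `K`-stable
  (unitarity), hence `𝒢`-stable (stabilisers of subspaces are algebraic, `stabSubmodule`), and
  Kolchin's theorem in the form `exists_notMem_forall_sub_mem` (Springer 2.4.12) applied to
  `W ≠ kᴺ` produces `w = w₁ + w₂ ∉ W` with `u w - w ∈ W`, whence `u w₂ - w₂ ∈ W ∩ W⊥ = 0` and
  `w ∈ W`; so `W = kᴺ` and `U = 1`.
* `exists_mem_forall_commute_of_le_zariskiClosure` — **a Zariski-dense subgroup `K` of a
  connected reductive `𝒢` contains a strongly regular element**: with `T` a maximal torus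
  (Springer 6.4.1, `exists_isMaximalTorusIn`), `Z_𝒢(T) = T` (**7.6.4 (ii)**,
  `centralizer_eq_of_isMaximalTorusIn_holds`) and `O` the open set of regular elements of `T`
  (6.4.3, `exists_isOpen_torusRegular`: `Z_𝒢(t) ⊆ Z_𝒢(T)` for `t ∈ T ∩ O`), Chevalley's theorem on
  images (1.9.5, `exists_isOpen_inter_closure_image_subset`) applied to the conjugation map
  `𝒢 × (T ∩ O) → 𝒢` together with the density of the conjugates of the Cartan subgroup
  (6.4.5 (iii), `subset_closure_conj_cartan`) gives a non-empty open subset of `𝒢` consisting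
  of conjugates `x t x⁻¹` of regular elements of `T`; it meets the dense subgroup `K`, and the
  centraliser in `𝒢` of such an element lies in the commutative group `x T x⁻¹`.
* `ExistsAbelianCentralizer_holds` — assembly: pull back along the injective `ρ`.
* `compactLie_exists_abelian_centralizer_holds` — the general (non-unitary) form
  `compactLie_exists_abelian_centralizer` of the same fact file: by Weyl's unitarian trick
  (Bröcker–tom Dieck II (1.7); tree `CompactGroup.unitarize`) a faithful continuous matrix
  representation is conjugate to a faithful continuous unitary one, to which
  `ExistsAbelianCentralizer_holds` applies.

For a compact connected Lie group this is the classical statement: `𝒢 = K_ℂ` is the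
complexification, `T ∩ K` a maximal torus of `K`, and the element found is a generator of a
maximal torus in the sense of Bröcker–tom Dieck IV (2.3)(i); the algebraic detour replaces the
mapping-degree argument by Borel's fixed point theorem (inside 6.4.5, 6.4.7, 7.6.4).

## References

* T. Bröcker, T. tom Dieck, *Representations of Compact Lie Groups*, GTM 98, Springer (1985),
  I (4.13), IV (1.6), IV (2.3)(i) [BrockerTomDieck1985].
* T. A. Springer, *Linear Algebraic Groups*, 2nd ed., Progress in Mathematics 9, Birkhäuser
  (1998), 1.9.5, 2.2.4, 2.4.12, 6.4.1, 6.4.3, 6.4.5 (iii), 7.6.4 (ii) [SpringerLAG1998].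
-/

noncomputable section

open Matrix MvPolynomial
open scoped MatrixGroups ComplexOrder

namespace Literature.RepresentationTheory.CompactGroups

open Literature.NumberTheory.Automorphic

/-! ### Strongly regular elements of a connected reductive group (Springer 6.4.3, 6.4.5, 7.6.4) -/

section Algebraic

variable {k : Type*} [Field k] {n : Type*} [Fintype n] [DecidableEq n]

/-- **A Zariski-dense subgroup of a connected reductive group contains an element with
commutative centraliser.** Let `𝒢 ≤ GL n k` (`k` algebraically closed) be connected reductive and
`K ≤ 𝒢` a subgroup with `𝒢 ≤ K̄`. Then some `g ∈ K` has the property that any two elements of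
`𝒢` commuting with `g` commute with each other. Proof: for a maximal torus `T` (6.4.1) one has
`Z_𝒢(T) = T` (Springer 7.6.4 (ii)); the regular elements `T ∩ O` of `T` (6.4.3) are dense in `T`,
so by the density of `⋃ₓ x T x⁻¹` (6.4.5 (iii)) the image of the conjugation morphism
`𝒢 × (T ∩ O) → 𝒢` is dense, and by Chevalley's theorem (1.9.5) it contains a non-empty open
subset of `𝒢`, which meets `K`; for `g = x t x⁻¹` in it, `Z_𝒢(g) = x Z_𝒢(t) x⁻¹ ⊆ x T x⁻¹` is
commutative. [cite: SpringerLAG1998, 6.4.3, 6.4.5 (iii), 7.6.4 (ii), 1.9.5] -/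
theorem exists_mem_forall_commute_of_le_zariskiClosure [IsAlgClosed k] {G K : Subgroup (GL n k)}
    (hG : IsConnectedReductive G) (hKG : K ≤ G) (hGK : G ≤ zariskiClosure K) :
    ∃ g ∈ K, ∀ a ∈ G, ∀ b ∈ G, a * g = g * a → b * g = g * b → a * b = b * a := by
  classical
  -- the Zariski topologies of `GL n k` and of the affine coordinate spaces (Springer 1.1, 2.1.4)
  letI : TopologicalSpace (GL n k) := zariskiTopologyGL n k
  letI : TopologicalSpace (GLCoord n → k) := zariskiTopologyPi (GLCoord n) k
  letI : TopologicalSpace (GLCoord n ⊕ GLCoord n → k) := zariskiTopologyPi (GLCoord n ⊕ GLCoord n) k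
  -- a maximal torus, its centraliser and its regular elements
  obtain ⟨T, hT⟩ := exists_isMaximalTorusIn G
  have hTt : IsTorusSubgroup T := hT.2.1
  haveI : IsMulCommutative ↥T := hTt.2.1
  have hZT : G ⊓ Subgroup.centralizer (T : Set (GL n k)) = T :=
    centralizer_eq_of_isMaximalTorusIn_holds hG hT
  obtain ⟨O, hO, ⟨t₁, ht₁T, ht₁O⟩, hreg⟩ := exists_isOpen_torusRegular hTt
  -- coordinates: `G' = G`, `Tr' = T ∩ O`, `V = G × (T ∩ O)`
  set Tr : Set (GL n k) := (T : Set (GL n k)) ∩ glCoordFun ⁻¹' O with hTrdef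
  set G' : Set (GLCoord n → k) := glCoordFun '' (G : Set (GL n k)) with hG'def
  set Tr' : Set (GLCoord n → k) := glCoordFun '' Tr with hTr'def
  have hG'cl : IsClosed G' := isClosedEmbedding_glCoordFun.isClosedMap _ hG.1.1.isClosed
  have hT'cl : IsClosed (glCoordFun '' (T : Set (GL n k))) :=
    isClosedEmbedding_glCoordFun.isClosedMap _ hTt.1.1.isClosed
  have hTr'eq : Tr' = glCoordFun '' (T : Set (GL n k)) ∩ O := by
    rw [hTr'def, hTrdef, Set.image_inter_preimage]
  have hTr'lc : IsLocallyClosed Tr' := by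
    rw [hTr'eq]
    exact hT'cl.isLocallyClosed.inter hO.isLocallyClosed
  set V : Set (GLCoord n ⊕ GLCoord n → k) := prodSet G' Tr' with hVdef
  have hVlc : IsLocallyClosed V := isLocallyClosed_prodSet hG'cl.isLocallyClosed hTr'lc
  have hmemV : ∀ {v : GLCoord n ⊕ GLCoord n → k}, v ∈ V ↔
      ∃ x ∈ G, ∃ t ∈ Tr, v = Sum.elim (glCoordFun x) (glCoordFun t) := by
    intro v
    constructor
    · rintro ⟨⟨x, hx, hxv⟩, ⟨t, ht, htv⟩⟩
      refine ⟨x, hx, t, ht, ?_⟩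
      rw [← sumElim_inl_inr v, ← hxv, ← htv]
    · rintro ⟨x, hx, t, ht, rfl⟩
      exact ⟨⟨x, hx, rfl⟩, ⟨t, ht, rfl⟩⟩
  have hVne : V.Nonempty :=
    ⟨_, hmemV.2 ⟨1, G.one_mem, t₁, ⟨ht₁T, ht₁O⟩, rfl⟩⟩
  -- the conjugation map `ψ (x, t) = x t x⁻¹`
  obtain ⟨P, hP⟩ := exists_poly_conj_pair (k := k) (n := n)
  set ψ : (GLCoord n ⊕ GLCoord n → k) → (GLCoord n → k) := fun v d => MvPolynomial.eval v (P d)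
    with hψdef
  have hψpt : ∀ x c : GL n k, ψ (Sum.elim (glCoordFun x) (glCoordFun c)) =
      glCoordFun (x * c * x⁻¹) :=
    fun x c => funext fun d => (hP x c d).symm
  have hψV : ψ '' V = glCoordFun '' {y | ∃ x ∈ G, ∃ t ∈ Tr, y = x * t * x⁻¹} := by
    apply Set.Subset.antisymm
    · rintro _ ⟨v, hv, rfl⟩
      obtain ⟨x, hx, t, ht, rfl⟩ := hmemV.1 hv
      exact ⟨x * t * x⁻¹, ⟨x, hx, t, ht, rfl⟩, (hψpt x t).symm⟩
    · rintro _ ⟨_, ⟨x, hx, t, ht, rfl⟩, rfl⟩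
      exact ⟨_, hmemV.2 ⟨x, hx, t, ht, rfl⟩, hψpt x t⟩
  have hψVG : ψ '' V ⊆ G' := by
    rw [hψV]
    rintro _ ⟨_, ⟨x, hx, t, ht, rfl⟩, rfl⟩
    exact ⟨_, G.mul_mem (G.mul_mem hx (hT.1 ht.1)) (G.inv_mem hx), rfl⟩
  -- density: `G ⊆ closure (ψ V)` (6.4.5 (iii) with the density of `T ∩ O` in `T`)
  have hTdense : (T : Set (GL n k)) ⊆ closure Tr :=
    subset_closure_inter_of_isPreirreducible_of_isOpen hTt.1.isIrreducible.isPreirreducible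
      (hO.preimage continuous_glCoordFun) ⟨t₁, ht₁T, ht₁O⟩
  have hGcl : (G : Set (GL n k)) ⊆ closure {y | ∃ x ∈ G, ∃ t ∈ Tr, y = x * t * x⁻¹} := by
    refine (subset_closure_conj_cartan hG.1 hT).trans (closure_minimal ?_ isClosed_closure)
    rintro _ ⟨x, hx, c, hc, rfl⟩
    have hcT : c ∈ T := by
      rw [← hZT]
      exact identityComponent_le _ hc
    -- `t ↦ x t x⁻¹` is continuous and maps `Tr` into our set
    have hcont : Continuous fun t : GL n k => x * t * x⁻¹ :=
      (continuous_mul_right_zariski x⁻¹).comp (continuous_mul_left_zariski x)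
    have h1 : x * c * x⁻¹ ∈ closure ((fun t : GL n k => x * t * x⁻¹) '' Tr) :=
      image_closure_subset_closure_image hcont ⟨c, hTdense hcT, rfl⟩
    refine closure_mono ?_ h1
    rintro _ ⟨t, ht, rfl⟩
    exact ⟨x, hx, t, ht, rfl⟩
  have hG'sub : G' ⊆ closure (ψ '' V) := by
    rw [hψV, hG'def]
    exact (Set.image_mono hGcl).trans (image_closure_subset_closure_image continuous_glCoordFun)
  have hcl : closure (ψ '' V) = G' := Set.Subset.antisymm (closure_minimal hψVG hG'cl) hG'sub
  -- Chevalley: a non-empty open subset of `G` inside `ψ V`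
  obtain ⟨W, hW, hWne, hWsub⟩ := exists_isOpen_inter_closure_image_subset hVlc hVne P
    (fun v d => rfl)
  rw [hcl] at hWne hWsub
  -- it meets the dense subgroup `K`
  obtain ⟨g, hgK, hgW⟩ : ∃ g ∈ K, glCoordFun g ∈ W := by
    obtain ⟨_, hwW, g₀, hg₀, rfl⟩ := hWne
    have hg₀cl : g₀ ∈ closure (K : Set (GL n k)) := mem_zariskiClosure_iff.1 (hGK hg₀)
    obtain ⟨g, hgW, hgK⟩ := mem_closure_iff.1 hg₀cl (glCoordFun ⁻¹' W)
      (hW.preimage continuous_glCoordFun) hwW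
    exact ⟨g, hgK, hgW⟩
  refine ⟨g, hgK, fun a ha b hb hag hbg => ?_⟩
  -- `g = x t x⁻¹` with `t` regular
  obtain ⟨v, hv, hvg⟩ := hWsub ⟨hgW, ⟨g, hKG hgK, rfl⟩⟩
  obtain ⟨x, hx, t, ⟨htT, htO⟩, rfl⟩ := hmemV.1 hv
  have hgeq : x * t * x⁻¹ = g := glCoordFun_injective ((hψpt x t).symm.trans hvg)
  -- `x⁻¹ a x` and `x⁻¹ b x` commute with `t`, hence lie in `Z_G(T) = T`
  have key : ∀ c ∈ G, c * g = g * c → x⁻¹ * c * x ∈ T := by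
    intro c hc hcg
    have hct : x⁻¹ * c * x * t = t * (x⁻¹ * c * x) := by
      rw [← hgeq] at hcg
      calc x⁻¹ * c * x * t = x⁻¹ * (c * (x * t * x⁻¹)) * x := by group
        _ = x⁻¹ * (x * t * x⁻¹ * c) * x := by rw [hcg]
        _ = t * (x⁻¹ * c * x) := by group
    have hcen := hreg t htT htO (x⁻¹ * c * x) hct
    rw [← hZT]
    exact ⟨G.mul_mem (G.mul_mem (G.inv_mem hx) hc) hx, hcen⟩
  have hab : (x⁻¹ * a * x) * (x⁻¹ * b * x) = (x⁻¹ * b * x) * (x⁻¹ * a * x) :=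
    congrArg Subtype.val
      (IsMulCommutative.is_comm.comm (⟨_, key a ha hag⟩ : ↥T) ⟨_, key b hb hbg⟩)
  have h2 : x⁻¹ * (a * b) * x = x⁻¹ * (b * a) * x := by
    calc x⁻¹ * (a * b) * x = (x⁻¹ * a * x) * (x⁻¹ * b * x) := by group
      _ = (x⁻¹ * b * x) * (x⁻¹ * a * x) := hab
      _ = x⁻¹ * (b * a) * x := by group
  exact mul_left_cancel (mul_right_cancel h2)

end Algebraic

/-! ### The Zariski closure of the image of a connected topological group is connected -/

section Connected

variable {k : Type*} [Field k] [TopologicalSpace k] [IsTopologicalRing k] [T1Space k]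
  {n : Type*} [Fintype n] [DecidableEq n]
  {G : Type*} [Group G] [TopologicalSpace G] [IsTopologicalGroup G] [ConnectedSpace G]

/-- **The Zariski closure of a continuous image of a connected group is Zariski-connected.** If
`φ : G →* GL n k` is a homomorphism from a connected topological group whose coordinates
`g ↦ (φ g)ᵢⱼ, det (φ g)⁻¹` are continuous (for the given Hausdorff ring topology of `k`), then
`K̄ = zariskiClosure φ(G)` has no proper algebraic subgroup of finite index: such an `H` pulls back
to a closed subgroup of finite index of `G`, which is open, hence all of `G`, so `φ(G) ≤ H`.
(Springer 2.2.1–2.2.4.) [folklore] -/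
theorem isZConnected_zariskiClosure_range_of_connectedSpace (φ : G →* GL n k)
    (hφ : Continuous fun g => glCoordFun (φ g)) :
    IsZConnected (zariskiClosure φ.range) := by
  classical
  refine ⟨isAlgebraicSubgroup_zariskiClosure _, fun H hHle hHalg hHfi => ?_⟩
  set 𝒢 : Subgroup (GL n k) := zariskiClosure φ.range with h𝒢def
  set H' : Subgroup G := H.comap φ with hH'def
  -- `H'` is closed
  have hcl : IsClosed (H' : Set G) := by
    obtain ⟨S, hS⟩ := hHalg
    have heq : (H' : Set G) = ⋂ p ∈ S, (fun g => MvPolynomial.eval (glCoordFun (φ g)) p) ⁻¹' {0} := by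
      ext g
      simp only [hH'def, Subgroup.coe_comap, Set.mem_preimage, Set.mem_iInter,
        Set.mem_singleton_iff]
      rw [hS]
      rfl
    rw [heq]
    exact isClosed_biInter fun p _ =>
      isClosed_singleton.preimage ((MvPolynomial.continuous_eval p).comp hφ)
  -- `H'` has finite index
  have hrange : ∀ g, φ g ∈ 𝒢 := fun g => le_zariskiClosure _ ⟨g, rfl⟩
  set φ' : G →* ↥𝒢 := φ.codRestrict 𝒢 hrange with hφ'def
  haveI : (H.subgroupOf 𝒢).FiniteIndex := hHfi
  have hH'eq : H' = (H.subgroupOf 𝒢).comap φ' := by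
    ext g
    simp only [hH'def, hφ'def, Subgroup.mem_comap, Subgroup.mem_subgroupOf,
      MonoidHom.codRestrict_apply]
  haveI hfi : H'.FiniteIndex := by
    rw [hH'eq]
    refine ⟨?_⟩
    rw [Subgroup.index_comap]
    exact (Subgroup.instFiniteIndex_subgroupOf _ _).index_ne_zero
  -- hence `H'` is open, hence everything
  have hop : IsOpen (H' : Set G) := Subgroup.isOpen_of_isClosed_of_finiteIndex H' hcl
  have htop : (H' : Set G) = Set.univ := IsClopen.eq_univ ⟨hcl, hop⟩ ⟨1, H'.one_mem⟩
  have hKH : φ.range ≤ H := by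
    rintro _ ⟨g, rfl⟩
    have hg : g ∈ (H' : Set G) := by rw [htop]; exact Set.mem_univ g
    exact hg
  exact le_antisymm hHle (zariskiClosure_le hHalg hKH)

end Connected

/-! ### The Zariski closure of a group of unitary matrices is reductive -/

section Reductive

variable {m : Type*} [Fintype m] [DecidableEq m]

omit [DecidableEq m] in
/-- **Hermitian orthogonal decomposition in coordinates**: every `v : m → ℂ` is `a + b` with `a`
in a given subspace `W` and `b` Hermitian-orthogonal to `W` (`star w ⬝ᵥ b = 0` for `w ∈ W`);
transported from `W ⊔ Wᗮ = ⊤` in `EuclideanSpace ℂ m`. [folklore] -/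
theorem exists_add_of_dotProduct_orthogonal (W : Submodule ℂ (m → ℂ)) (v : m → ℂ) :
    ∃ a ∈ W, ∃ b : m → ℂ, (∀ w ∈ W, star w ⬝ᵥ b = 0) ∧ v = a + b := by
  let e : EuclideanSpace ℂ m →ₗ[ℂ] (m → ℂ) := (WithLp.linearEquiv 2 ℂ (m → ℂ)).toLinearMap
  have he : ∀ x : EuclideanSpace ℂ m, e x = WithLp.ofLp x := fun x => rfl
  let P : Submodule ℂ (EuclideanSpace ℂ m) := W.comap e
  have hmemP : ∀ {x : EuclideanSpace ℂ m}, x ∈ P ↔ WithLp.ofLp x ∈ W := fun {x} => Iff.rfl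
  have htop : P ⊔ Pᗮ = ⊤ := Submodule.sup_orthogonal_of_hasOrthogonalProjection
  have hv : (WithLp.toLp 2 v : EuclideanSpace ℂ m) ∈ P ⊔ Pᗮ := by
    rw [htop]; exact Submodule.mem_top
  obtain ⟨a, ha, b, hb, hab⟩ := Submodule.mem_sup.1 hv
  refine ⟨WithLp.ofLp a, hmemP.1 ha, WithLp.ofLp b, fun w hw => ?_, ?_⟩
  · have hw' : (WithLp.toLp 2 w : EuclideanSpace ℂ m) ∈ P := by
      rw [hmemP]; exact hw
    have h := Submodule.inner_right_of_mem_orthogonal hw' hb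
    rw [EuclideanSpace.inner_eq_star_dotProduct, WithLp.ofLp_toLp, dotProduct_comm] at h
    exact h
  · have h := congrArg WithLp.ofLp hab
    rw [WithLp.ofLp_add, WithLp.ofLp_toLp] at h
    exact h.symm

/-- **The Zariski closure of a group of unitary matrices is reductive.** Let `K ≤ GL m ℂ` consist
of unitary matrices and `𝒢 = K̄`. If `U ≤ 𝒢` is normal in `𝒢` and consists of unipotent matrices,
let `W` be the space of common fixed vectors of `U`; it is `𝒢`-stable (normality), so its
Hermitian orthogonal `W⊥` is `K`-stable (unitarity), hence `𝒢`-stable, the stabiliser of a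
subspace being algebraic (`stabSubmodule`, Springer 2.3.1). Were `W ≠ ℂᵐ`, Kolchin's theorem
(Springer 2.4.12, `exists_notMem_forall_sub_mem`) would give `w = w₁ + w₂ ∉ W` (`w₁ ∈ W`,
`w₂ ∈ W⊥`) with `u w - w ∈ W` for all `u ∈ U`; then `u w₂ - w₂ ∈ W ∩ W⊥ = 0`, so `w₂ ∈ W ∩ W⊥ = 0`
and `w ∈ W`, a contradiction. Hence `W = ℂᵐ` and `U = 1` (connectedness of `U` is not used).
This is the algebraic shadow of Weyl's unitarian trick: `𝒢` has a faithful semisimple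
representation. [cite: SpringerLAG1998, 2.4.12 with 2.3.1] -/
theorem isReductiveSubgroup_zariskiClosure_of_mem_unitaryGroup (K : Subgroup (GL m ℂ))
    (hK : ∀ g ∈ K, (g : Matrix m m ℂ) ∈ Matrix.unitaryGroup m ℂ) :
    IsReductiveSubgroup (zariskiClosure K) := by
  classical
  set 𝒢 : Subgroup (GL m ℂ) := zariskiClosure K with h𝒢def
  refine ⟨isAlgebraicSubgroup_zariskiClosure K, fun U hUG hN _ hunip => ?_⟩
  -- the common fixed vectors of `U`
  let Wfix : Submodule ℂ (m → ℂ) :=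
    { carrier := {v | ∀ u ∈ U, ((u : GL m ℂ) : Matrix m m ℂ) *ᵥ v = v}
      add_mem' := fun {v w} hv hw u hu => by rw [Matrix.mulVec_add, hv u hu, hw u hu]
      zero_mem' := fun u _ => Matrix.mulVec_zero _
      smul_mem' := fun c v hv u hu => by rw [Matrix.mulVec_smul, hv u hu] }
  have hmemWfix : ∀ {v : m → ℂ}, v ∈ Wfix ↔ ∀ u ∈ U, ((u : GL m ℂ) : Matrix m m ℂ) *ᵥ v = v :=
    fun {v} => Iff.rfl
  -- normality: `g⁻¹ u g ∈ U` for `g ∈ 𝒢`, `u ∈ U`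
  have hconj : ∀ g ∈ 𝒢, ∀ u ∈ U, g⁻¹ * u * g ∈ U := by
    intro g hg u hu
    have h := hN.conj_mem ⟨u, hUG hu⟩ (Subgroup.mem_subgroupOf.2 hu) ⟨g⁻¹, 𝒢.inv_mem hg⟩
    rw [Subgroup.mem_subgroupOf] at h
    simpa using h
  -- `Wfix` is `𝒢`-stable
  have hWfixG : ∀ g ∈ 𝒢, ∀ v ∈ Wfix, ((g : GL m ℂ) : Matrix m m ℂ) *ᵥ v ∈ Wfix := by
    intro g hg v hv u hu
    have h := hv _ (hconj g hg u hu)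
    rw [Units.val_mul, Units.val_mul, ← Matrix.mulVec_mulVec, ← Matrix.mulVec_mulVec] at h
    have h' := congrArg (fun w => ((g : GL m ℂ) : Matrix m m ℂ) *ᵥ w) h
    simp only [Matrix.mulVec_mulVec] at h'
    rwa [← mul_assoc, ← mul_assoc, ← Units.val_mul, mul_inv_cancel, Units.val_one,
      Matrix.one_mul, ← Matrix.mulVec_mulVec] at h'
  -- the Hermitian orthogonal of `Wfix`
  let Wperp : Submodule ℂ (m → ℂ) :=
    { carrier := {w | ∀ v ∈ Wfix, star v ⬝ᵥ w = 0}
      add_mem' := fun {w w'} hw hw' v hv => by rw [dotProduct_add, hw v hv, hw' v hv, add_zero]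
      zero_mem' := fun v _ => dotProduct_zero _
      smul_mem' := fun c w hw v hv => by rw [dotProduct_smul, hw v hv, smul_zero] }
  have hmemWperp : ∀ {w : m → ℂ}, w ∈ Wperp ↔ ∀ v ∈ Wfix, star v ⬝ᵥ w = 0 := fun {w} => Iff.rfl
  -- `Wperp` is `K`-stable (unitarity) ...
  have hWperpK : K ≤ stabSubmodule Wperp := by
    intro g hg
    rw [mem_stabSubmodule_iff]
    intro w hw v hv
    have hunit : star ((g : GL m ℂ) : Matrix m m ℂ) * (g : Matrix m m ℂ) = 1 :=
      Matrix.mem_unitaryGroup_iff'.1 (hK g hg)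
    have hinv : ((g⁻¹ : GL m ℂ) : Matrix m m ℂ) = ((g : GL m ℂ) : Matrix m m ℂ)ᴴ := by
      rw [Matrix.coe_units_inv]
      exact Matrix.inv_eq_left_inv hunit
    have hv' : ((g⁻¹ : GL m ℂ) : Matrix m m ℂ) *ᵥ v ∈ Wfix :=
      hWfixG _ (le_zariskiClosure K (K.inv_mem hg)) v hv
    have h := hw _ hv'
    rw [hinv, Matrix.star_mulVec, Matrix.conjTranspose_conjTranspose] at h
    rwa [Matrix.dotProduct_mulVec]
  -- ... hence `𝒢`-stable
  have hWperpG : 𝒢 ≤ stabSubmodule Wperp :=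
    zariskiClosure_le (isAlgebraicSubgroup_stabSubmodule _) hWperpK
  -- `Wfix ∩ Wperp = 0` and `Wfix + Wperp = ℂᵐ`
  have hinf : ∀ w ∈ Wfix, w ∈ Wperp → w = 0 := fun w h1 h2 =>
    dotProduct_star_self_eq_zero.1 (h2 w h1)
  -- `Wfix = ⊤` by Kolchin
  have hWfix : Wfix = ⊤ := by
    by_contra hne
    set S : Submonoid (Module.End ℂ (m → ℂ)) :=
      (U.toSubmonoid.map (Units.coeHom (Matrix m m ℂ))).map
        (Matrix.toLinAlgEquiv' (R := ℂ) (n := m)).toAlgHom.toMonoidHom with hS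
    have hSunip : ∀ s ∈ S, IsNilpotent (s - 1) := by
      rintro _ ⟨_, ⟨u, hu, rfl⟩, rfl⟩
      have h := (hunip u hu).map (Matrix.toLinAlgEquiv' (R := ℂ) (n := m))
      rw [map_sub, map_one] at h
      exact h
    have hSW : ∀ s ∈ S, ∀ w ∈ Wfix, s w ∈ Wfix := by
      rintro _ ⟨_, ⟨u, hu, rfl⟩, rfl⟩ w hw
      change Matrix.toLin' ((u : GL m ℂ) : Matrix m m ℂ) w ∈ Wfix
      rw [Matrix.toLin'_apply, hw u hu]
      exact hw
    obtain ⟨w, hw, hsw⟩ := exists_notMem_forall_sub_mem S hSunip hSW hne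
    obtain ⟨a, ha, b, hb, rfl⟩ := exists_add_of_dotProduct_orthogonal Wfix w
    have hbperp : b ∈ Wperp := hb
    have hbfix : b ∈ Wfix := by
      intro u hu
      have h1 := hsw _ ⟨_, ⟨u, hu, rfl⟩, rfl⟩
      change Matrix.toLin' ((u : GL m ℂ) : Matrix m m ℂ) (a + b) - (a + b) ∈ Wfix at h1
      rw [Matrix.toLin'_apply, Matrix.mulVec_add, ha u hu, add_sub_add_left_eq_sub] at h1
      have h2 : ((u : GL m ℂ) : Matrix m m ℂ) *ᵥ b - b ∈ Wperp :=
        Wperp.sub_mem ((mem_stabSubmodule_iff.1 (hWperpG (hUG hu))) b hbperp) hbperp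
      exact sub_eq_zero.1 (hinf _ h1 h2)
    exact hw (Wfix.add_mem ha hbfix)
  -- hence `U = 1`
  refine (Subgroup.eq_bot_iff_forall U).2 fun u hu => ?_
  have hall : ∀ v : m → ℂ, ((u : GL m ℂ) : Matrix m m ℂ) *ᵥ v = v := fun v =>
    (hmemWfix.1 (hWfix ▸ Submodule.mem_top : v ∈ Wfix)) u hu
  refine Units.ext ?_
  rw [Units.val_one]
  apply (Matrix.toLin' (R := ℂ) (n := m)).injective
  rw [Matrix.toLin'_one]
  exact LinearMap.ext fun v => by rw [Matrix.toLin'_apply, LinearMap.id_apply, hall]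

end Reductive

/-! ### The discharge of `ExistsAbelianCentralizer` -/

section Main

/-- **A compact connected group with a faithful unitary matrix representation has an element with
abelian centraliser** (Bröcker–tom Dieck IV (2.3)(i) with I (4.13): a generator of a maximal torus)
— discharge of the named fact `ExistsAbelianCentralizer`. Proof (module docstring): view `ρ` as
`φ : G →* GL_N(ℂ)`; the Zariski closure `𝒢` of `φ(G)` is Zariski-connected (`G` is connected and
the coordinates of `φ` are continuous) and reductive (unitarity), so by Springer 6.4.3,
6.4.5 (iii), 7.6.4 (ii) and Chevalley's theorem some `φ(t)`, `t ∈ G`, has commutative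
centraliser in `𝒢 ⊇ φ(G)`; as `φ` is injective, `Z_G(t)` is abelian.
[cite: BrockerTomDieck1985, IV (2.3)(i) and I (4.13); SpringerLAG1998, 7.6.4 (ii), 6.4.3,
6.4.5 (iii), 1.9.5] -/
theorem ExistsAbelianCentralizer_holds : ExistsAbelianCentralizer := by
  intro G _ _ _ _ _ N ρ hρc hρi hρu
  classical
  -- `ρ` as a homomorphism to `GL N ℂ` (a unitary matrix is invertible with inverse its adjoint)
  let φ : G →* GL (Fin N) ℂ :=
    { toFun := fun g => ⟨ρ g, star (ρ g), Matrix.mem_unitaryGroup_iff.1 (hρu g),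
        Matrix.mem_unitaryGroup_iff'.1 (hρu g)⟩
      map_one' := Units.ext (by simp)
      map_mul' := fun a b => Units.ext (by simp) }
  have hφval : ∀ g, ((φ g : GL (Fin N) ℂ) : Matrix (Fin N) (Fin N) ℂ) = ρ g := fun g => rfl
  have hφinj : Function.Injective φ := fun a b h => hρi (by
    have h' := congrArg (fun u : GL (Fin N) ℂ => (u : Matrix (Fin N) (Fin N) ℂ)) h
    simpa only [hφval] using h')
  -- the coordinates of `φ` are continuous
  have hdet : ∀ g, ((ρ g).det)⁻¹ = ((ρ g)ᴴ).det := fun g => by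
    have h := congrArg Matrix.det (Matrix.mem_unitaryGroup_iff.1 (hρu g))
    rw [Matrix.det_mul, Matrix.det_one, Matrix.star_eq_conjTranspose] at h
    exact inv_eq_of_mul_eq_one_right h
  have hφcont : Continuous fun g => glCoordFun (φ g) := by
    refine continuous_pi fun c => ?_
    rcases c with ⟨i, j⟩ | u
    · simp only [glCoordFun_inl, hφval]
      exact hρc.matrix_elem i j
    · simp only [glCoordFun_inr, hφval, hdet]
      exact hρc.matrix_conjTranspose.matrix_det
  -- the Zariski closure of `φ(G)` is connected reductive
  have hconn : IsZConnected (zariskiClosure φ.range) :=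
    isZConnected_zariskiClosure_range_of_connectedSpace φ hφcont
  have hred : IsReductiveSubgroup (zariskiClosure φ.range) :=
    isReductiveSubgroup_zariskiClosure_of_mem_unitaryGroup φ.range
      (by rintro _ ⟨g, rfl⟩; exact hρu g)
  -- a strongly regular element of `φ(G)`
  obtain ⟨_, ⟨t, rfl⟩, ht⟩ := exists_mem_forall_commute_of_le_zariskiClosure ⟨hconn, hred⟩
    (le_zariskiClosure φ.range) le_rfl
  refine ⟨t, fun a b hat hbt => ?_⟩
  have h := ht (φ a) (le_zariskiClosure _ ⟨a, rfl⟩) (φ b) (le_zariskiClosure _ ⟨b, rfl⟩)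
    (by rw [← map_mul, ← map_mul, hat]) (by rw [← map_mul, ← map_mul, hbt])
  exact hφinj (by rw [map_mul, map_mul, h])

end Main

/-! ### The general (non-unitary) form, by Weyl's unitarian trick -/

section General

/-- **A compact connected group with a faithful continuous matrix representation has an element
with abelian centraliser** — discharge of the named fact `compactLie_exists_abelian_centralizer`
(the form of `ExistsAbelianCentralizer` without the unitarity hypothesis; Bröcker–tom Dieck
IV (2.3)(i) with I (4.13)). Proof: by Weyl's unitarian trick (II (1.7) with (1.6); tree
`CompactGroup.unitarize`, `CompactGroup.unitarize_mem_unitaryGroup`) the representation `ρ` is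
conjugate, `σ = B ρ B⁻¹` with `B` invertible, to a continuous unitary representation `σ`, which is
still faithful since `ρ = B⁻¹ σ B`; apply `ExistsAbelianCentralizer_holds` to `σ`.
[cite: BrockerTomDieck1985, IV (2.3)(i), I (4.13) and II (1.7)] -/
theorem compactLie_exists_abelian_centralizer_holds : compactLie_exists_abelian_centralizer := by
  intro G _ _ _ _ _ N ρ hρc hρi
  have hB := CompactGroup.isUnit_det_unitarizer ρ hρc
  -- conjugating back by `B⁻¹` recovers `ρ`, so the unitarised representation is faithful
  have key : ∀ g, (CompactGroup.unitarizer ρ hρc)⁻¹ * CompactGroup.unitarize ρ hρc g *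
      CompactGroup.unitarizer ρ hρc = ρ g := fun g => by
    rw [CompactGroup.unitarize_apply]
    simp only [Matrix.mul_assoc, Matrix.nonsing_inv_mul _ hB, Matrix.mul_one]
    exact Matrix.nonsing_inv_mul_cancel_left _ _ hB
  exact ExistsAbelianCentralizer_holds G N (CompactGroup.unitarize ρ hρc)
    (CompactGroup.continuous_unitarize ρ hρc)
    (fun a b hab => hρi (by rw [← key a, ← key b, hab]))
    (CompactGroup.unitarize_mem_unitaryGroup ρ hρc)

end General

end Literature.RepresentationTheory.CompactGroups
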